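import Summits.CriticalPhenomena.SAWScalingLimit.Theses.SAWExcursionCardy
import Literature.Probability.LatticeModels.SRWKilledWalkFunctionals
import Literature.Probability.RandomPlanarGeometry.SAWExcursionAvoidance
import Literature.Probability.Percolation.BoxCrossingProofs

/-!
# Birth skeleton (`Lines/birth.lean`) for crux `SlitExcursionCardy` (stmt-CriticalPhenomena-4512)

Route `SAWExcursionCardy` of `CriticalPhenomena/SAWScalingLimit`, crux r3 `SlitExcursionCardy` — the
Cardy–Fomin formula for the critical `ℤ²` SAW × independent random-walk excursion in MARTINGALE-READY
form: for every conformal rectangle `(Ω; a, c, d, b)`, every admissible `ρ`-separated SAW prefix `η`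
(tip `v`, past `S = η ∖ {v}`, slit graph `G_η = Ω_δ − S`), eventually in the mesh,
`|N_δ(η) − h_S · F(min(1, √Λ_η))| ≤ ε`, where `N_δ(η)` is the conditional non-intersection probability
given the prefix, `h_S` the probability that the `c → d` excursion of `Ω_δ` avoids the past, `Λ_η` the
killed-walk Green cross-ratio of `(v, c, d, b)` in `G_η`, and `F(u) = (8/5) u ₂F₁(−1/2, 2; 7/2; u)`.

## The cut: exact factorisation · SAW restriction law (exponent 5/8) · random-walk Fomin–Kozdron moment

The crux docstring records the route planner's own reading: "exact identity `N_δ(η) = h_S · Ñ(G_η; v, b; c, d)`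
(restriction of the excursion measure + domain Markov of `x_c^|γ|`), so the content is `Ñ → F` uniformly over
slit domains".  This skeleton types that identity as ONE provable stub and splits the content `Ñ → F` along
the mechanism that produces Cardy–Fomin formulas for `κ = 8/3` in the continuum — the RESTRICTION PROPERTY:
for chordal SLE_{8/3} from `v` to `b` and an independent Brownian excursion `β` from `c` to `d`,
`P[γ ∩ β = ∅ | β] = P[Brownian excursion v → b avoids β]^{5/8}` (Lawler–Schramm–Werner 2003, Thm. 5.4 /
restriction formula `Φ'_A(0)^{5/8}`), and averaging over `β` gives Kozdron's closed form
`P[γ ∩ β = ∅] = F(u)` (Kozdron 2009, Thm. 8.1, `κ = 8/3`).  On the lattice, with the route's killed-walk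
excursion functional `E_Gr(p, q; A) = SRW.exitAfterAvoiding Gr p q A` (tree vocabulary, literally the crux's
inline `let E`; `SRW.killedGreen` is its `let Gf`, `sawExcursionF` its `let F`):

* `stub_factorisation : Factorisation` (M/L, provable now) — DOMAIN-MARKOV × RESTRICTION FACTORISATION:
  `N_δ(η) = h_S · Ñ(G_η; v, b; c, d)` exactly, where `Ñ = slitAvoid` is the INTRINSIC slit-graph quantity
  `Σ_q x_c^{|q|} E_{G_η}(c, d; q) / Σ_q x_c^{|q|} / E_{G_η}(c, d; ∅)` over self-avoiding paths `q` of `G_η`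
  from the tip `v` to `b` (the conditional law of the `x_c`-SAW given its prefix is the `x_c`-SAW of the slit
  graph; the walk part is the tree's restriction identity `SRW.exitAfterAvoiding_of_adj_iff`:
  `E_{G_η}(c,d;A) = E_{Ω_δ}(c,d;A ∪ S)` when `d` has no `Ω_δ`-neighbour in `S`).  Hypotheses: bounded `Ω`,
  `δ > 0`, `η` a path of positive conditional mass, `c, d ∉ S`, no `Ω_δ`-neighbour of `d` in `S`.
* `stub_sawRestriction : SAWRestrictionLaw` (open-problem; HARDEST) — LSW's RESTRICTION LAW WITH EXPONENT 5/8
  for the slit-graph SAW, tested against random-walk excursion hulls, in excursion average: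
  `h_S · |Ñ(G_η; v,b; c,d) − M(G_η; v,b; c,d)| ≤ ε` uniformly over admissible prefixes, where
  `M = restrictionMoment` is the AVERAGE OVER THE `c → d` EXCURSION `ω` OF `G_η` of
  `(G_{G_η − trace ω}(v, b) / G_{G_η}(v, b))^{5/8}`, the killed-Green-function ratio of `(v, b)` with and
  without the excursion's trace deleted (lattice currency for `H_{D∖ω}(v,b)/H_D(v,b)` = probability that an
  independent Brownian excursion from the tip `v` to `b` avoids `ω`).  By Fubini `Ñ = E_ω[P_SAW(γ ∩ ω = ∅)]`,
  so the stub says `P_SAW^{G_η; v→b}[γ ∩ ω = ∅ | ω] = (G_{G_η−ω}(v,b)/G_{G_η}(v,b))^{5/8} + o(1)` AFTER AVERAGING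
  OVER `ω` (weaker than `L¹(ω)`): the lattice form of "SAW = restriction measure of exponent 5/8"
  (LawlerSchrammWerner2003Restriction for SLE_{8/3}; LawlerSchrammWerner2004SAW §3.4 for the SAW prediction;
  Kennedy2004 = arXiv:math/0207231 for Monte-Carlo tests), the SAW input of the line.
* `stub_excursionMoment : ExcursionMoment` (XL; theorem-shaped, random-walk only) — the LATTICE FOMIN–KOZDRON
  MOMENT: `h_S · |M(G_η; v,b; c,d) − F(min(1, √Λ_η))| ≤ ε` uniformly over admissible prefixes.  Its continuum
  shadow is a THEOREM: `E_β[(H_{D∖β}(v,b)/H_D(v,b))^{5/8}] = P[SLE_{8/3}(v→b) ∩ β = ∅] = F(u)` for an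
  independent Brownian excursion `β` from `c` to `d` (LSW 2003 restriction formula + Kozdron 2009 Thm. 8.1,
  `a = 2/κ = 3/4`), with `√Λ → u` the Kozdron–Lawler cross-ratio limit (route support `RWGreenCrossRatioLimit`,
  slit-uniform version); the lattice passage (invariance principle for killed-walk excursions, Green-function
  ratios of random-walk hulls, uniformly over slit domains; Beurling/Kesten near the tip) is unvendored.
* `SlitExcursionCardy_of` (kernel-checked, no `sorry`): eventually `δ < ρ`, so `ρ`-separation puts `c_δ, d_δ`
  and every `Ω_δ`-neighbour of `d_δ` off the past; the factorisation turns the crux's left side into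
  `h_S · (Ñ − F)`, and `h_S ≥ 0` (tree: `SRW.exitAfterAvoiding_ratio_nonneg`) with the two weighted bounds at
  `ε/2` gives the crux BY NAME (the named form `CruxNamed` is the route decl by `Iff.rfl`).

The weight `h_S` in stubs 2–3 is the crux's own safety margin (route review g2, note (iii)): the claims are
void exactly when the past nearly seals `c_δ` from `d_δ`, so a neck/fjord counterexample must keep `h_S`
bounded below — the stubs are crux-strength, not stronger.

## Disproof / negatives used
* `Cruxes/SlitExcursionCardy/`: no workfiles at registration (`ledger crux ls stmt-CriticalPhenomena-4512`,
  2026-08-17) — no `Disproof.lean`, no `_false_without_` obstruction to honour, no dead lines.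
* `ledger negatives --problem CriticalPhenomena`: the SAW negatives (all-`δ` tightness stmt-0772 and its kin)
  concern tightness, not this observable; every statement here is eventual in `δ` and asserts no tightness.
* Vacuity pass: when `d_δ` is sealed from `c_δ` in `G_η` all of `h_S`, `Ñ`, `M`, `Λ` vanish and the bounds
  are `0 ≤ ε` (true, as in the crux — route review g2 note (ii)); `0 < law(X)` excludes sealed tips; the
  `tsum`s in `slitAvoid` run over the finite type of self-avoiding paths of a finite-support graph.
-/

noncomputable section

open scoped BigOperators Topology Classical MeasureTheory ProbabilityTheory
open Filter Set MeasureTheory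
open Literature.Probability.LatticeModels Literature.Probability.RandomPlanarGeometry

namespace Summit.CriticalPhenomena.SAWScalingLimit.Cruxes.SlitExcursionCardy.Birth

/-! ### 1. Vocabulary (the crux's inline `let`s, named; walk functionals in tree vocabulary) -/

/-- The PAST of a prefix `η` with tip `v`: its vertices other than the tip (the crux's `S`). -/
def past {Gr : SimpleGraph (Site 2)} {u v : Site 2} (η : Gr.Walk u v) : Set (Site 2) :=
  {w | w ∈ η.support ∧ w ≠ v}

/-- The SLIT GRAPH `Gr − S`: `Gr` with the vertex set `S` deleted (the crux's `Gη`, verbatim). -/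
def slit (Gr : SimpleGraph (Site 2)) (S : Set (Site 2)) : SimpleGraph (Site 2) :=
  SimpleGraph.fromRel (fun x y => Gr.Adj x y ∧ x ∉ S ∧ y ∉ S)

/-- The conditioning event `X = {γ extends η}` (the crux's `X`, verbatim). -/
def ext (Ω : Set ℂ) (δ : ℝ) (a b : Site 2) {v : Site 2} (η : (discreteDomainGraph Ω δ).Walk a v) :
    Set (SAW.DomainSAW Ω δ a b) :=
  {γ | ∃ q : (discreteDomainGraph Ω δ).Walk v b, γ.walk = η.append q}

/-- The CONDITIONAL NON-INTERSECTION PROBABILITY `N_δ(η)` given the prefix `η` (the crux's `condAvoid`,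
verbatim with `E = SRW.exitAfterAvoiding`; also `SAW.condExcursionAvoidance`, see `condAvoid_eq`). -/
def condAvoid (Ω : Set ℂ) (δ : ℝ) (a b c d : Site 2) {v : Site 2}
    (η : (discreteDomainGraph Ω δ).Walk a v) : ℝ :=
  (∫ γ in ext Ω δ a b η, SRW.exitAfterAvoiding (discreteDomainGraph Ω δ) c d {w | w ∈ γ.walk.support}
      ∂(SAW.law Ω δ a b)) /
    (SAW.law Ω δ a b).real (ext Ω δ a b η) / SRW.exitAfterAvoiding (discreteDomainGraph Ω δ) c d ∅

/-- `h_S`: the probability that the `c → d` excursion of `Ω_δ` avoids the past (the crux's `hS`). -/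
def pastAvoid (Ω : Set ℂ) (δ : ℝ) (c d : Site 2) {a v : Site 2}
    (η : (discreteDomainGraph Ω δ).Walk a v) : ℝ :=
  SRW.exitAfterAvoiding (discreteDomainGraph Ω δ) c d (past η) /
    SRW.exitAfterAvoiding (discreteDomainGraph Ω δ) c d ∅

/-- The killed-walk GREEN CROSS-RATIO `Λ = G(v,d)G(c,b)/(G(v,c)G(d,b))` of `(v, c, d, b)` in `Gr`
(the crux's `Λ`, with `Gf = SRW.killedGreen`). -/
def greenCrossRatio (Gr : SimpleGraph (Site 2)) (v b c d : Site 2) : ℝ :=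
  SRW.killedGreen Gr v d * SRW.killedGreen Gr c b / (SRW.killedGreen Gr v c * SRW.killedGreen Gr d b)

/-- `Ñ(Gr; v, b; c, d)`: the INTRINSIC non-intersection probability of the `x_c`-weighted self-avoiding
path of `Gr` from `v` to `b` and the independent `c → d` excursion of `Gr` —
`Σ_q x_c^{|q|} E_Gr(c,d; q) / Σ_q x_c^{|q|} / E_Gr(c,d; ∅)` over self-avoiding `q`. -/
def slitAvoid (Gr : SimpleGraph (Site 2)) (v b c d : Site 2) : ℝ :=
  (∑' q : {q : Gr.Walk v b // q.IsPath},
      SAW.criticalFugacity ^ q.1.length * SRW.exitAfterAvoiding Gr c d {w | w ∈ q.1.support}) /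
    (∑' q : {q : Gr.Walk v b // q.IsPath}, SAW.criticalFugacity ^ q.1.length) /
    SRW.exitAfterAvoiding Gr c d ∅

/-- The TRACE of the walk from `p` run along `Gr`-edges: the positions visited up to (and including)
its first non-`Gr` step. -/
def trace (Gr : SimpleGraph (Site 2)) (p : Site 2) (ω : SRW.PathSpace 2) : Set (Site 2) :=
  {w | ∃ j : ℕ, (∀ i < j, Gr.Adj (p + SRW.S ω i) (p + SRW.S ω (i + 1))) ∧ w = p + SRW.S ω j}

/-- The EXCURSION EVENT `c → d` of `Gr`: the walk from `c` follows `Gr`-edges, stands at `d`, and its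
next step is not a `Gr`-edge (the event of `E_Gr(c,d;∅)`). -/
def excursions (Gr : SimpleGraph (Site 2)) (p q : Site 2) : Set (SRW.PathSpace 2) :=
  {ω | ∃ n : ℕ, (∀ j < n, Gr.Adj (p + SRW.S ω j) (p + SRW.S ω (j + 1))) ∧
    ¬ Gr.Adj (p + SRW.S ω n) (p + SRW.S ω (n + 1)) ∧ p + SRW.S ω n = q}

/-- The RESTRICTION MOMENT `M(Gr; v, b; c, d)`: the average over the `c → d` excursion `ω` of `Gr`
(event `excursions Gr c d`, mass `E_Gr(c,d;∅)`) of `(G_{Gr − trace ω}(v,b) / G_Gr(v,b))^{5/8}`, the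
`5/8`-th power of the killed-Green-function ratio of `(v, b)` with and without the excursion's trace
deleted — on the lattice `G_{Gr−K}(v,b)/G_Gr(v,b)` is the route's boundary-kernel currency (local factors
at `v`, `b` cancel, Kozdron–Lawler 2005) for `H_{D∖K}(v,b)/H_D(v,b) = P[Brownian excursion v → b avoids K]`,
whose `5/8`-th power is `P[SLE_{8/3}(v → b) ∩ K = ∅]` (LSW 2003 restriction formula).  The integrand takes
finitely many values on a finite-support graph (it factors through `trace ω ⊆` the component of `c`), so
the Bochner integral is a finite sum, not a junk `0`. -/
def restrictionMoment (Gr : SimpleGraph (Site 2)) (v b c d : Site 2) : ℝ :=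
  (∫ ω in excursions Gr c d,
      (SRW.killedGreen (slit Gr (trace Gr c ω)) v b / SRW.killedGreen Gr v b) ^ ((5 : ℝ) / 8)
      ∂(SRW.pathLaw 2)) /
    SRW.exitAfterAvoiding Gr c d ∅

/-- `condAvoid` is the Literature observable `SAW.condExcursionAvoidance` (definitional). -/
theorem condAvoid_eq (Ω : Set ℂ) (δ : ℝ) (a b c d : Site 2) {v : Site 2}
    (η : (discreteDomainGraph Ω δ).Walk a v) :
    condAvoid Ω δ a b c d η = SAW.condExcursionAvoidance Ω δ a b c d η := rfl

/-- `pastAvoid` is the Literature avoidance ratio of the past (definitional). -/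
theorem pastAvoid_eq (Ω : Set ℂ) (δ : ℝ) (c d : Site 2) {a v : Site 2}
    (η : (discreteDomainGraph Ω δ).Walk a v) :
    pastAvoid Ω δ c d η = SRWExcursion.avoidRatio (discreteDomainGraph Ω δ) c d (past η) := rfl

/-! ### 2. The admissibility frame of the crux and the three statements -/

/-- The crux's quantifier frame: conformal rectangle `R = (Ω; a, c, d, b)`, endpoint approximation of
`(Ω; a, b)`, boundary vertices `c_δ → c`, `d_δ → d`; then `∀ ε ρ > 0`, eventually in `δ`, for every
self-avoiding prefix `η` from `a_δ` to a tip `v`, `ρ`-separated from `δc_δ, δd_δ, δb_δ`, of positive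
conditional mass, with `c_δ ~ b_δ` in the slit graph: `P`. -/
def Frame (P : ∀ (Ω : Set ℂ) (δ : ℝ) (a b c d : Site 2) (ε : ℝ) (v : Site 2),
    (discreteDomainGraph Ω δ).Walk a v → Prop) : Prop :=
  ∀ (R : ConformalRectangle) (a b c d : ℝ → Site 2),
    SAW.IsEndpointApprox (R.chord 0 3 (by decide)) a b →
    Filter.Tendsto (fun δ => meshPoint δ (c δ)) (nhdsWithin 0 (Set.Ioi 0)) (nhds (R.pt 1)) →
    Filter.Tendsto (fun δ => meshPoint δ (d δ)) (nhdsWithin 0 (Set.Ioi 0)) (nhds (R.pt 2)) →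
    (∀ᶠ δ in nhdsWithin 0 (Set.Ioi 0), c δ ∈ meshBoundary R.carrier δ ∧ d δ ∈ meshBoundary R.carrier δ) →
    ∀ ε > (0 : ℝ), ∀ ρ > (0 : ℝ), ∀ᶠ δ in nhdsWithin 0 (Set.Ioi 0),
      ∀ (v : Site 2) (η : (discreteDomainGraph R.carrier δ).Walk (a δ) v), η.IsPath →
        (∀ w ∈ η.support, ρ ≤ dist (meshPoint δ w) (meshPoint δ (c δ)) ∧
          ρ ≤ dist (meshPoint δ w) (meshPoint δ (d δ)) ∧ ρ ≤ dist (meshPoint δ w) (meshPoint δ (b δ))) →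
        0 < (SAW.law R.carrier δ (a δ) (b δ)).real (ext R.carrier δ (a δ) (b δ) η) →
        (slit (discreteDomainGraph R.carrier δ) (past η)).Reachable (c δ) (b δ) →
        P R.carrier δ (a δ) (b δ) (c δ) (d δ) ε v η

/-- The crux in named form. -/
def CruxNamed : Prop :=
  Frame fun Ω δ a b c d ε v η =>
    |condAvoid Ω δ a b c d η - pastAvoid Ω δ c d η *
        sawExcursionF (min 1 (Real.sqrt
          (greenCrossRatio (slit (discreteDomainGraph Ω δ) (past η)) v b c d)))| ≤ ε

/-- `CruxNamed` IS the route decl (every name above unfolds to the crux's inline term). -/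
theorem cruxNamed_iff :
    CruxNamed ↔ Summit.CriticalPhenomena.SAWScalingLimit.Theses.SAWExcursionCardy.SlitExcursionCardy :=
  Iff.rfl

/-- STUB 1 statement — **domain-Markov × restriction factorisation** `N_δ(η) = h_S · Ñ(G_η; v,b; c,d)`. -/
def Factorisation : Prop :=
  ∀ (Ω : Set ℂ) (δ : ℝ) (a b c d v : Site 2) (η : (discreteDomainGraph Ω δ).Walk a v),
    Bornology.IsBounded Ω → 0 < δ → η.IsPath →
    0 < (SAW.law Ω δ a b).real (ext Ω δ a b η) →
    c ∉ past η → d ∉ past η → (∀ s ∈ past η, ¬ (discreteDomainGraph Ω δ).Adj d s) →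
      condAvoid Ω δ a b c d η =
        pastAvoid Ω δ c d η * slitAvoid (slit (discreteDomainGraph Ω δ) (past η)) v b c d

/-- STUB 2 statement — **SAW restriction law with exponent 5/8 against excursion hulls** (weighted by
`h_S`, uniform over admissible prefixes): `h_S · |Ñ − M| ≤ ε`. -/
def SAWRestrictionLaw : Prop :=
  Frame fun Ω δ _a b c d ε v η =>
    pastAvoid Ω δ c d η *
      |slitAvoid (slit (discreteDomainGraph Ω δ) (past η)) v b c d -
        restrictionMoment (slit (discreteDomainGraph Ω δ) (past η)) v b c d| ≤ ε

/-- STUB 3 statement — **lattice Fomin–Kozdron moment** (weighted by `h_S`, uniform over admissible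
prefixes): `h_S · |M − F(min(1, √Λ))| ≤ ε`. -/
def ExcursionMoment : Prop :=
  Frame fun Ω δ _a b c d ε v η =>
    pastAvoid Ω δ c d η *
      |restrictionMoment (slit (discreteDomainGraph Ω δ) (past η)) v b c d -
        sawExcursionF (min 1 (Real.sqrt
          (greenCrossRatio (slit (discreteDomainGraph Ω δ) (past η)) v b c d)))| ≤ ε

/-! ### 3. The registered stubs (the ONLY `sorry`s of this file) -/

/-- STUB 1 (M/L, provable now): exact factorisation `N_δ(η) = h_S · Ñ` (domain Markov of `x_c^{|γ|}` +
the tree's restriction identity `SRW.exitAfterAvoiding_of_adj_iff`). -/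
theorem stub_factorisation : Factorisation := by
  sorry

/-- STUB 2 (open-problem, HARDEST): the slit SAW obeys LSW's restriction law with exponent `5/8` against
random-walk excursion hulls, after averaging over the excursion, uniformly over admissible prefixes
(weighted by `h_S`). -/
theorem stub_sawRestriction : SAWRestrictionLaw := by
  sorry

/-- STUB 3 (XL, random-walk only): the excursion average of (`v → b` excursion avoids `ω`)^{5/8} in the
slit graph is `F(min(1, √Λ_η)) + o(1)`, uniformly over admissible prefixes (continuum: LSW 2003 + Kozdron
2009 Thm. 8.1; lattice passage à la Kozdron–Lawler 2005). -/
theorem stub_excursionMoment : ExcursionMoment := by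
  sorry

/-! ### Name-keyed aliases of the stub statements (hypotheses of the composition)

The skeleton audit admits a hypothesis of `SlitExcursionCardy_of` iff its head constant is a registered
obligation or is NAMED like a declared stub; `__Registered.stub_X` is the statement of `stub_X` under that
name (device of `Cruxes/AxiomsOfLimit/Lines/birth.lean`). Each alias is `rfl`-equal to its statement. -/
namespace __Registered

/-- Alias of `Factorisation` keyed by the registered stub name. -/
abbrev stub_factorisation : Prop := Factorisation
/-- Alias of `SAWRestrictionLaw` keyed by the registered stub name. -/
abbrev stub_sawRestriction : Prop := SAWRestrictionLaw
/-- Alias of `ExcursionMoment` keyed by the registered stub name. -/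
abbrev stub_excursionMoment : Prop := ExcursionMoment

end __Registered

/-! ### 4. The composition (kernel-checked, no `sorry` of its own) -/

/-- **`SlitExcursionCardy` from the three stubs**, concluding the route decl BY NAME.  Eventually
`0 < δ < ρ`; then `ρ`-separation puts `c_δ`, `d_δ` and the `Ω_δ`-neighbours of `d_δ` (at mesh distance
`δ < ρ` from `δd_δ`) off the past, STUB 1 rewrites `N_δ(η) = h_S · Ñ`, and
`|h_S Ñ − h_S F| = h_S |Ñ − F| ≤ h_S |Ñ − M| + h_S |M − F| ≤ ε/2 + ε/2` by STUBS 2–3. -/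
theorem SlitExcursionCardy_of (h₁ : __Registered.stub_factorisation)
    (h₂ : __Registered.stub_sawRestriction) (h₃ : __Registered.stub_excursionMoment) :
    Summit.CriticalPhenomena.SAWScalingLimit.Theses.SAWExcursionCardy.SlitExcursionCardy := by
  refine cruxNamed_iff.1 ?_
  intro R a b c d hab hc hd hbd ε hε ρ hρ
  have hε2 : (0 : ℝ) < ε / 2 := half_pos hε
  have hIoo : Set.Ioo (0 : ℝ) ρ ∈ nhdsWithin (0 : ℝ) (Set.Ioi 0) := Ioo_mem_nhdsGT hρ
  filter_upwards [h₂ R a b c d hab hc hd hbd (ε / 2) hε2 ρ hρ,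
    h₃ R a b c d hab hc hd hbd (ε / 2) hε2 ρ hρ, hIoo] with δ H₂ H₃ hδ
  intro v η hpath hsep hpos hreach
  -- `ρ`-separation, read at mesh `δ < ρ`
  have hnot : ∀ w ∈ η.support, w ≠ c δ ∧ w ≠ d δ ∧ ¬ (discreteDomainGraph R.carrier δ).Adj (d δ) w := by
    intro w hw
    obtain ⟨hwc, hwd, -⟩ := hsep w hw
    refine ⟨?_, ?_, ?_⟩
    · rintro rfl
      rw [dist_self] at hwc
      exact absurd hwc (not_le.2 hρ)
    · rintro rfl
      rw [dist_self] at hwd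
      exact absurd hwd (not_le.2 hρ)
    · intro hadj
      have hzd : (zdGraph 2).Adj (d δ) w :=
        meshGraph_le_zdGraph _ _ (discreteDomainGraph_le_meshGraph _ _ hadj)
      have hdist : dist (meshPoint δ w) (meshPoint δ (d δ)) = |δ| := by
        rw [dist_comm]
        exact Literature.Probability.Percolation.dist_meshPoint_of_adj hzd
      rw [hdist, abs_of_pos hδ.1] at hwd
      exact absurd (hwd.trans_lt hδ.2) (lt_irrefl ρ)
  have hcS : c δ ∉ past η := fun h => (hnot _ h.1).1 rfl
  have hdS : d δ ∉ past η := fun h => (hnot _ h.1).2.1 rfl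
  have hnb : ∀ s ∈ past η, ¬ (discreteDomainGraph R.carrier δ).Adj (d δ) s :=
    fun s hs => (hnot s hs.1).2.2
  -- STUB 1: `N_δ(η) = h_S · Ñ`
  have hfac := h₁ R.carrier δ (a δ) (b δ) (c δ) (d δ) v η R.isBounded hδ.1 hpath hpos hcS hdS hnb
  -- STUBS 2–3 at `ε/2`
  have e₂ : pastAvoid R.carrier δ (c δ) (d δ) η *
      |slitAvoid (slit (discreteDomainGraph R.carrier δ) (past η)) v (b δ) (c δ) (d δ) -
        restrictionMoment (slit (discreteDomainGraph R.carrier δ) (past η)) v (b δ) (c δ) (d δ)| ≤ ε / 2 :=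
    H₂ v η hpath hsep hpos hreach
  have e₃ : pastAvoid R.carrier δ (c δ) (d δ) η *
      |restrictionMoment (slit (discreteDomainGraph R.carrier δ) (past η)) v (b δ) (c δ) (d δ) -
        sawExcursionF (min 1 (Real.sqrt
          (greenCrossRatio (slit (discreteDomainGraph R.carrier δ) (past η)) v (b δ) (c δ) (d δ))))| ≤
      ε / 2 :=
    H₃ v η hpath hsep hpos hreach
  have h0 : 0 ≤ pastAvoid R.carrier δ (c δ) (d δ) η :=
    SRW.exitAfterAvoiding_ratio_nonneg _ _ _ _
  show |condAvoid R.carrier δ (a δ) (b δ) (c δ) (d δ) η - pastAvoid R.carrier δ (c δ) (d δ) η *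
      sawExcursionF (min 1 (Real.sqrt
        (greenCrossRatio (slit (discreteDomainGraph R.carrier δ) (past η)) v (b δ) (c δ) (d δ))))| ≤ ε
  rw [hfac, ← mul_sub, abs_mul, abs_of_nonneg h0]
  calc pastAvoid R.carrier δ (c δ) (d δ) η *
        |slitAvoid (slit (discreteDomainGraph R.carrier δ) (past η)) v (b δ) (c δ) (d δ) -
          sawExcursionF (min 1 (Real.sqrt
            (greenCrossRatio (slit (discreteDomainGraph R.carrier δ) (past η)) v (b δ) (c δ) (d δ))))|
      ≤ pastAvoid R.carrier δ (c δ) (d δ) η *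
          (|slitAvoid (slit (discreteDomainGraph R.carrier δ) (past η)) v (b δ) (c δ) (d δ) -
              restrictionMoment (slit (discreteDomainGraph R.carrier δ) (past η)) v (b δ) (c δ) (d δ)| +
            |restrictionMoment (slit (discreteDomainGraph R.carrier δ) (past η)) v (b δ) (c δ) (d δ) -
              sawExcursionF (min 1 (Real.sqrt
                (greenCrossRatio (slit (discreteDomainGraph R.carrier δ) (past η)) v (b δ) (c δ) (d δ))))|) :=
        mul_le_mul_of_nonneg_left (abs_sub_le _ _ _) h0
    _ ≤ ε / 2 + ε / 2 := by rw [mul_add]; exact add_le_add e₂ e₃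
    _ = ε := add_halves ε

/-- Wiring check (an `example`, so that `SlitExcursionCardy_of` stays the only theorem concluding the
crux): the registered stubs feed the composition as stated. -/
example : Summit.CriticalPhenomena.SAWScalingLimit.Theses.SAWExcursionCardy.SlitExcursionCardy :=
  SlitExcursionCardy_of stub_factorisation stub_sawRestriction stub_excursionMoment

end Summit.CriticalPhenomena.SAWScalingLimit.Cruxes.SlitExcursionCardy.Birth

end
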